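import Summits.CriticalPhenomena.PercolationContinuityZ3.Theorems.Transplant.KNLevelsTargetPropertyUniform
import HarnessLib

/-!
# F7 (generic), part 4 — the target property UNIFORM IN THE GRAPH AND IN THE PARAMETER (`∃ δ` before `∀ p < 1` and `∀ G`), and the
# p-uniform chain engine (U2; refuter p5-g3's check item D13 "constants uniform on `[p/2, p]`" at the generic layer)

builds on p205010 (kernel theorem, internal audit signed; external expert review pending) — only `targetPropertyUP_KN` uses it (through
`KNLevels.avoidingGluing_KN` ← `CSH.kozmaNitzan_conjecture3_holds`).
Lane `prim-bschramm`, seat `prim-bschramm-stmt` (gen 5); helper file (`--supports stmt-CriticalPhenomena-4575`).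

WHY.  Design (D) ("re-run at `q₀ < p`", HOME/ENTRY-SEED-STAR.md §10–§11; stmt `BoxProdZ2DropAssembly.thetaDropBoxProdZ2_of_inputs`) fixes the
finite-volume input family — hence the input accuracy `δ_in` — AT `p`, and then runs the anchored-cells scheme at EVERY `q ∈ [p/2, p]` at which the
inputs still hold; the kits delivered there (`BoxProdZ2.kitClauseQ`) have accuracy `√δ_in`, so the accuracy `δ` demanded by the chain / step
lemmas must be known BEFORE `q` is.  The landed engine (`TargetPropertyU V Δ p`, p217247; `BoxProdZ2ChainU.chain_edge_tube X hΔ p …`, p218617)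
quantifies `∃ δ` AFTER the parameter, which gives no uniformity over the uncountably many `q`.  But the witness in the proof of
`targetPropertyU_of_avoidingGluing` is `δ = ε · min(δ_{C3}, 1) / 12` with `δ_{C3}` from the (parameter-free) gluing schema `AvoidingGluing V` at
`ε / 2`: the parameter enters only through Step II's count hypothesis `1/(1-p)^{ΔN} ≤ δ·#levels` and Step III's `(1 - p^{s_B})^k ≤ δ`, both
HYPOTHESES of `KitsAt`.  Hence, at no mathematical cost:
* **`KNLevels.TargetPropertyUP V Δ`** — `∀ ε > 0, ∃ δ ∈ (0,1], ∀ p < 1, ∀ G` (locally finite, `deg ≤ Δ`) the body of `TargetProperty G Δ p` at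
  `(ε, δ)` verbatim;
* **`targetPropertyUP_of_avoidingGluing`**, **`targetPropertyUP_KN`** (unconditional); `TargetPropertyUP.targetPropertyU` (back to U1);
* the p-uniform twins of the engine: **`TargetPropertyUP.apply_step`**, **`TargetPropertyUP.chain`**, **`TargetPropertyUP.chain_edge`** — `∃ δ`
  before `∀ p < 1, ∀ G, ∀ W s …`, bodies of `TargetPropertyU.apply_step / chain / chain_edge` verbatim.
The product specialisations (`∃ δ, ∀ q < 1, ∀ π, …` = the `hstep` / `hchain` hypotheses of p2-g2's `cond_of_tubeStep` / `hreach_of_tubeChain` for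
all parameters at once) are in `BoxProdZ2ChainUP`.
[cite: KozmaNitzan2024, §4 Lemma 10 (pp. 17–22), Lemma 11 (p. 22), Lemma 12 (pp. 23–25); Conjecture 3 (p. 15)] [cite: GrimmettPercolation1999, §7.2]
-/

noncomputable section

open MeasureTheory ProbabilityTheory

namespace Summit.CriticalPhenomena.PercolationContinuityZ3.Theorems

namespace Transplant

namespace KNLevels

open Literature.Probability.Percolation Literature.Probability.LatticeModels SimpleGraph

/-! ## §1 The target property, uniform in the graph and in the parameter -/

/-- **The target property, uniform in the graph on the vertex type `V` AND in the parameter `p < 1`**: for every `ε > 0` ONE `δ ∈ (0,1]`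
such that for EVERY `p < 1` and EVERY locally finite `G : SimpleGraph V` with degrees `≤ Δ` the conclusion of the generic target lemma holds at
`(ε, δ)` (body of `TargetProperty G Δ p` verbatim). [cite: KozmaNitzan2024, §4 Lemma 10 (p. 17)] -/
def TargetPropertyUP (V : Type) [DecidableEq V] (Δ : ℕ) : Prop :=
  ∀ ⦃ε : ℝ⦄, 0 < ε → ∃ δ : ℝ, 0 < δ ∧ δ ≤ 1 ∧ ∀ (p : unitInterval), (p : ℝ) < 1 →
    ∀ (G : SimpleGraph V) [G.LocallyFinite], (∀ x, G.degree x ≤ Δ) →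
    ∀ (L : LData G) (W : Sym2 V → unitInterval) (D T : Finset V) (R N j₀ j₁ : ℕ),
    LHyp L W p D R → j₁ ≤ R → T ⊆ D → T.Nonempty →
    1 / (1 - (p : ℝ)) ^ (Δ * N) ≤ δ * ((Finset.Icc j₀ j₁).card : ℝ) →
    (∀ j ∈ Finset.Icc j₀ j₁, ∃ (σ : SData V) (S : Finset V), SHyp L j σ ∧ σ.N ≤ N ∧
      (1 - (p : ℝ) ^ σ.sB) ^ σ.k ≤ δ ∧ S ⊆ L.X j ∧ S ⊆ D ∧
      (∀ x ∈ σ.K, ∀ e ∈ σ.seed x, e ∉ wireSet (↑S : Set V)) ∧ (∀ x ∈ σ.K, σ.face x ⊆ S) ∧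
      (∀ x ∈ σ.K, 1 - 3 * δ ≤ (prodBernoulli W).real {ω | ∃ u ∈ σ.face x,
        1 - δ < (prodBernoulli (pinW W (wireSet (↑S : Set V)) ω)).real (⋃ t ∈ T, openConnIn (↑D : Set V) u t)})) →
    1 - δ < (prodBernoulli W).real L.reachB →
      1 - ε < (prodBernoulli W).real (⋃ t ∈ T, openConn L.o t)

variable {V : Type} [DecidableEq V]

/-- **The parameter-uniform target property from the avoiding gluing schema**: the proof of `targetPropertyU_of_avoidingGluing` with the
parameter and the graph introduced after Step I (`δ = ε · min(δ_{C3}, 1) / 12` depends on the schema and `ε` only).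
[cite: KozmaNitzan2024, §4 Lemma 10 (pp. 17–22)] -/
theorem targetPropertyUP_of_avoidingGluing [Countable V] {Δ : ℕ} (hC : AvoidingGluing V) : TargetPropertyUP V Δ := by
  classical
  intro ε hε
  -- trivial when `ε > 1`
  rcases le_or_gt ε 1 with hε1 | hε1
  swap
  · refine ⟨1, one_pos, le_rfl, fun p _ G _ _ L W D T R N j₀ j₁ _ _ _ _ _ _ _ => ?_⟩
    exact lt_of_lt_of_le (by linarith) measureReal_nonneg
  -- Step I: the constants `δ_{C3}`, `δ` — from the schema and `ε` only
  obtain ⟨δ₀, hδ₀, hC3⟩ := hC (ε / 2) (half_pos hε)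
  set δc : ℝ := min δ₀ 1 with hδc
  have hδc0 : 0 < δc := lt_min hδ₀ one_pos
  have hδc1 : δc ≤ 1 := min_le_right _ _
  set δ : ℝ := ε * δc / 12 with hδdef
  have hδpos : 0 < δ := by positivity
  have hδc' : δ ≤ δc := by rw [hδdef]; nlinarith
  have h3δ : 3 * δ ≤ 1 := by rw [hδdef]; nlinarith
  have h12 : 12 * δ ≤ ε * δc := by rw [hδdef]; linarith
  have hδ1 : δ ≤ 1 := by linarith
  -- the gluing hypothesis at `δc ≤ δ₀`
  have hC3' : ∀ (w : Sym2 V → unitInterval) (Sf : Finset V), (∀ e : Sym2 V, (∃ x ∈ e, x ∉ Sf) → w e = 0) →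
      ∀ (A T' : Finset V) (o : V) (Rg : Set V), A ⊆ Sf → T' ⊆ Sf → o ∈ Sf → T'.Nonempty → o ∉ Rg →
        1 - δc < (prodBernoulli w).real (⋃ a ∈ A, openConn o a) →
          (∀ a ∈ A, 1 - δc < (prodBernoulli w).real (⋃ t ∈ T', openConnIn Rg a t)) →
            1 - ε / 2 < (prodBernoulli w).real (⋃ t ∈ T', openConn o t) := by
    intro w Sf hw A T' o Rg hA hT' ho hne hoRg hoA haT
    have hle : 1 - δ₀ ≤ 1 - δc := by linarith [min_le_left δ₀ 1]
    exact hC3 w Sf hw A T' o Rg hA hT' ho hne hoRg (hle.trans_lt hoA) fun a ha => hle.trans_lt (haT a ha)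
  -- now the parameter and the graph
  refine ⟨δ, hδpos, hδ1, fun p hp1 G _ hΔ L W D T R N j₀ j₁ hL hj₁ hTD hTne hJ hkits hreach => ?_⟩
  -- Step II: a level with many contacts
  obtain ⟨j, hjJ, hII⟩ := hL.stepII hΔ hp1 (N := N) hj₁ hJ hreach
  have hjR : j ≤ R := (Finset.mem_Icc.1 hjJ).2.trans hj₁
  -- the kit at that level
  obtain ⟨σ, S, hσ, hN, hIII, hSX, hSD, hSseed, hUS, hIV⟩ := hkits j hjJ
  -- Steps III–V
  exact hL.targetLemma_of_kit hσ hjR hN hSX hSD hSseed hUS hTD hTne hε hε1 hδpos hδc' h3δ h12 hII hIII hIV hC3'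

/-- **The parameter-uniform target property, unconditionally**, on every countable vertex type and for every degree bound `Δ` —
builds on p205010 (kernel theorem, internal audit signed; external expert review pending) through `avoidingGluing_KN`.
[cite: KozmaNitzan2024, §4 Lemma 10 (pp. 17–22)] -/
theorem targetPropertyUP_KN [Countable V] {Δ : ℕ} : TargetPropertyUP V Δ :=
  targetPropertyUP_of_avoidingGluing avoidingGluing_KN

/-- **Back to the graph-uniform property at one parameter** (U1; nothing landed is disturbed). [cite: KozmaNitzan2024, §4 Lemma 10 (p. 17)] -/
theorem TargetPropertyUP.targetPropertyU {Δ : ℕ} (h : TargetPropertyUP V Δ) (p : unitInterval) (hp1 : (p : ℝ) < 1) :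
    TargetPropertyU V Δ p :=
  fun _ hε => by
    obtain ⟨δ, hδ, hδ1, h'⟩ := h hε
    exact ⟨δ, hδ, hδ1, fun G _ hΔ => h' p hp1 G hΔ⟩

/-- **Back to the per-graph property.** [cite: KozmaNitzan2024, §4 Lemma 10 (p. 17)] -/
theorem TargetPropertyUP.targetProperty {Δ : ℕ} (h : TargetPropertyUP V Δ) {p : unitInterval} (hp1 : (p : ℝ) < 1)
    {G : SimpleGraph V} [G.LocallyFinite] (hΔ : ∀ x, G.degree x ≤ Δ) : TargetProperty G Δ p :=
  (h.targetPropertyU p hp1).targetProperty hΔ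

/-! ## §2 Parameter-uniform chains -/

/-- **One application to a step with kits, uniformly in the parameter and the graph.** [cite: KozmaNitzan2024, §4 Lemma 10 (p. 17)] -/
theorem TargetPropertyUP.apply_step {Δ : ℕ} (hT : TargetPropertyUP V Δ) {ε : ℝ} (hε : 0 < ε) :
    ∃ δ : ℝ, 0 < δ ∧ δ ≤ 1 ∧ ∀ (p : unitInterval), (p : ℝ) < 1 → ∀ (G : SimpleGraph V) [G.LocallyFinite], (∀ x, G.degree x ≤ Δ) →
      ∀ (W : Sym2 V → unitInterval) (s : TStep G), s.KitsAt W p Δ δ →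
      1 - δ < (prodBernoulli W).real s.L.reachB → 1 - ε < (prodBernoulli W).real (⋃ t ∈ s.T, openConn s.L.o t) := by
  obtain ⟨δ, hδ, hδ1, h⟩ := hT hε
  refine ⟨δ, hδ, hδ1, fun p hp1 G _ hΔ W s hk hreach => ?_⟩
  obtain ⟨hL, hj, hTD, hTne, hJ, hkits⟩ := hk
  exact h p hp1 G hΔ s.L W s.D s.T s.R s.N s.j₀ s.j₁ hL hj hTD hTne hJ hkits hreach

/-- **Parameter-uniform CHAINS of target steps**: for every `ε > 0` and `n` ONE `δ ∈ (0, 1]` serving every parameter `p < 1`, every graph on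
`V` with degrees `≤ Δ`, every weighting and every linked chain of `n + 1` steps with kits at accuracy `δ` (body of `TargetPropertyU.chain`
verbatim). [cite: KozmaNitzan2024, §4 Lemma 11 (p. 22), Lemma 12 (p. 24)] -/
theorem TargetPropertyUP.chain {Δ : ℕ} (hT : TargetPropertyUP V Δ) (n : ℕ) {ε : ℝ} (hε : 0 < ε) :
    ∃ δ : ℝ, 0 < δ ∧ δ ≤ 1 ∧ ∀ (p : unitInterval), (p : ℝ) < 1 → ∀ (G : SimpleGraph V) [G.LocallyFinite], (∀ x, G.degree x ≤ Δ) →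
      ∀ (W : Sym2 V → unitInterval) (s : Fin (n + 1) → TStep G),
      (∀ i : Fin (n + 1), (s i).L.o = (s 0).L.o) →
      (∀ i : Fin n, (s (Fin.castSucc i)).T ⊆ (s i.succ).L.X 0) →
      (∀ i : Fin (n + 1), (s i).KitsAt W p Δ δ) →
      1 - δ < (prodBernoulli W).real (s 0).L.reachB →
        1 - ε < (prodBernoulli W).real (⋃ t ∈ (s (Fin.last n)).T, openConn (s 0).L.o t) := by
  induction n generalizing ε with
  | zero =>
    obtain ⟨δ, hδ, hδ1, h⟩ := hT.apply_step hε
    refine ⟨δ, hδ, hδ1, fun p hp1 G _ hΔ W s _ _ hk hreach => ?_⟩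
    exact h p hp1 G hΔ W (s 0) (hk 0) hreach
  | succ n ih =>
    -- the last step at `ε`, the first `n + 1` steps at `ε' = δ_last`
    obtain ⟨δ₁, hδ₁, hδ₁1, hlast⟩ := hT.apply_step hε
    obtain ⟨δ₀, hδ₀, hδ₀1, hfirst⟩ := ih hδ₁
    refine ⟨min δ₀ δ₁, lt_min hδ₀ hδ₁, (min_le_left _ _).trans hδ₀1, fun p hp1 G _ hΔ W s ho hlink hk hreach => ?_⟩
    -- the truncated chain
    set s' : Fin (n + 1) → TStep G := fun i => s (Fin.castSucc i) with hs'
    have ho' : ∀ i : Fin (n + 1), (s' i).L.o = (s' 0).L.o := fun i => by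
      simp only [hs']; rw [ho (Fin.castSucc i)]; exact (ho (Fin.castSucc 0)).symm
    have hlink' : ∀ i : Fin n, (s' (Fin.castSucc i)).T ⊆ (s' i.succ).L.X 0 := fun i => by
      simp only [hs']
      have := hlink (Fin.castSucc i)
      have e : (Fin.castSucc i).succ = Fin.castSucc i.succ := Fin.ext (by simp)
      rwa [e] at this
    have hk' : ∀ i : Fin (n + 1), (s' i).KitsAt W p Δ δ₀ := fun i => (hk (Fin.castSucc i)).mono (min_le_left _ _)
    have h0 : (s' 0).L.o = (s 0).L.o := rfl
    have hreach' : 1 - δ₀ < (prodBernoulli W).real (s' 0).L.reachB := by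
      have : (s' 0) = s 0 := rfl
      rw [this]; exact lt_of_le_of_lt (by linarith [min_le_left δ₀ δ₁]) hreach
    have hmid := hfirst p hp1 G hΔ W s' ho' hlink' hk' hreach'
    -- `T_n ⊆ X_{n+1}(0)`: the last step's `B` is reached
    have hlastlink : (s' (Fin.last n)).T ⊆ (s (Fin.last (n + 1))).L.X 0 := by
      have := hlink (Fin.last n)
      simp only [hs']
      rwa [Fin.succ_last] at this
    have holast : (s (Fin.last (n + 1))).L.o = (s 0).L.o := ho _
    have hreachLast : 1 - δ₁ < (prodBernoulli W).real (s (Fin.last (n + 1))).L.reachB := by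
      refine lt_of_lt_of_le ?_ (real_reachB_ge_of_subset W (s := s' (Fin.last n)) (s' := s (Fin.last (n + 1)))
        (by rw [holast]; exact ho' (Fin.last n) |>.trans h0 |>.symm) hlastlink)
      have e : (s' (Fin.last n)).L.o = (s 0).L.o := (ho' (Fin.last n)).trans h0
      rw [e]; exact hmid
    have := hlast p hp1 G hΔ W (s (Fin.last (n + 1))) ((hk _).mono (min_le_right _ _)) hreachLast
    rwa [holast] at this

/-- **Parameter-uniform CHAINS with enlarged targets** (edge contacts): for every `ε > 0` and `n` ONE `δ ∈ (0, 1]` serving every parameter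
`p < 1` and every graph on `V` with degrees `≤ Δ` — every weighting, every chain `s₀, …, s_n` with a common source, true targets `T'_i ⊆ T_i`
linked by `T'_i ⊆ X_{i+1}(0)`, kits at accuracy `δ`, excess `P_W(o ↔ T_i \ T'_i) ≤ η ≤ δ/2`: `1 - δ < P_W(o ↔ X_0(0))` implies
`1 - ε < P_W(o ↔ T'_n)` (body of `TargetPropertyU.chain_edge` verbatim).  With this, design (D) picks ONE `δ_chain` before `p`, valid at every
`q ∈ [p/2, p]`. [cite: KozmaNitzan2024, §4 Lemma 11 (p. 22), Lemma 12 (pp. 23–25)] -/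
theorem TargetPropertyUP.chain_edge {Δ : ℕ} (hT : TargetPropertyUP V Δ) (n : ℕ) {ε : ℝ} (hε : 0 < ε) :
    ∃ δ : ℝ, 0 < δ ∧ δ ≤ 1 ∧ ∀ (p : unitInterval), (p : ℝ) < 1 → ∀ (G : SimpleGraph V) [G.LocallyFinite], (∀ x, G.degree x ≤ Δ) →
      ∀ (W : Sym2 V → unitInterval) (s : Fin (n + 1) → TStep G) (T' : Fin (n + 1) → Finset V) (η : ℝ),
      (∀ i : Fin (n + 1), (s i).L.o = (s 0).L.o) →
      (∀ i : Fin n, T' (Fin.castSucc i) ⊆ (s i.succ).L.X 0) →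
      (∀ i : Fin (n + 1), T' i ⊆ (s i).T) →
      (∀ i : Fin (n + 1), (s i).KitsAt W p Δ δ) →
      η ≤ δ / 2 →
      (∀ i : Fin (n + 1), (prodBernoulli W).real (⋃ t ∈ (s i).T \ T' i, openConn (s 0).L.o t) ≤ η) →
      1 - δ < (prodBernoulli W).real (s 0).L.reachB →
        1 - ε < (prodBernoulli W).real (⋃ t ∈ T' (Fin.last n), openConn (s 0).L.o t) := by
  induction n generalizing ε with
  | zero =>
    obtain ⟨δ₁, hδ₁, hδ₁1, h⟩ := hT.apply_step (half_pos hε)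
    refine ⟨min δ₁ ε, lt_min hδ₁ hε, (min_le_left _ _).trans hδ₁1, fun p hp1 G _ hΔ W s T' η _ _ hsub hk hη hexc hreach => ?_⟩
    have h1 := h p hp1 G hΔ W (s 0) ((hk 0).mono (min_le_left _ _)) (lt_of_le_of_lt (by linarith [min_le_left δ₁ ε]) hreach)
    have h2 := real_biUnion_openConn_le_add_sdiff (prodBernoulli W) (s 0).L.o (hsub 0)
    have h3 := hexc 0
    have h4 : η ≤ ε / 2 := hη.trans (by linarith [min_le_right δ₁ ε])
    show 1 - ε < (prodBernoulli W).real (⋃ t ∈ T' 0, openConn (s 0).L.o t)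
    linarith
  | succ n ih =>
    obtain ⟨δ₁, hδ₁, hδ₁1, hlast⟩ := hT.apply_step (half_pos hε)
    obtain ⟨δ₀, hδ₀, hδ₀1, hfirst⟩ := ih hδ₁
    refine ⟨min δ₀ (min δ₁ ε), lt_min hδ₀ (lt_min hδ₁ hε), (min_le_left _ _).trans hδ₀1,
      fun p hp1 G _ hΔ W s T' η ho hlink hsub hk hη hexc hreach => ?_⟩
    have hmin0 : min δ₀ (min δ₁ ε) ≤ δ₀ := min_le_left _ _
    have hmin1 : min δ₀ (min δ₁ ε) ≤ δ₁ := (min_le_right _ _).trans (min_le_left _ _)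
    have hminε : min δ₀ (min δ₁ ε) ≤ ε := (min_le_right _ _).trans (min_le_right _ _)
    -- the truncated chain
    set s' : Fin (n + 1) → TStep G := fun i => s (Fin.castSucc i) with hs'
    set T'' : Fin (n + 1) → Finset V := fun i => T' (Fin.castSucc i) with hT''
    have ho' : ∀ i : Fin (n + 1), (s' i).L.o = (s' 0).L.o := fun i => by
      simp only [hs']; rw [ho (Fin.castSucc i)]; exact (ho (Fin.castSucc 0)).symm
    have h0 : (s' 0).L.o = (s 0).L.o := rfl
    have hlink' : ∀ i : Fin n, T'' (Fin.castSucc i) ⊆ (s' i.succ).L.X 0 := fun i => by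
      simp only [hs', hT'']
      have := hlink (Fin.castSucc i)
      have e : (Fin.castSucc i).succ = Fin.castSucc i.succ := Fin.ext (by simp)
      rwa [e] at this
    have hsub' : ∀ i : Fin (n + 1), T'' i ⊆ (s' i).T := fun i => hsub (Fin.castSucc i)
    have hk' : ∀ i : Fin (n + 1), (s' i).KitsAt W p Δ δ₀ := fun i => (hk (Fin.castSucc i)).mono hmin0
    have hη' : η ≤ δ₀ / 2 := hη.trans (by linarith)
    have hexc' : ∀ i : Fin (n + 1), (prodBernoulli W).real (⋃ t ∈ (s' i).T \ T'' i, openConn (s' 0).L.o t) ≤ η := fun i => by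
      rw [h0]; exact hexc (Fin.castSucc i)
    have hreach' : 1 - δ₀ < (prodBernoulli W).real (s' 0).L.reachB := by
      have : (s' 0) = s 0 := rfl
      rw [this]; exact lt_of_le_of_lt (by linarith) hreach
    have hmid := hfirst p hp1 G hΔ W s' T'' η ho' hlink' hsub' hk' hη' hexc' hreach'
    -- `T'_n ⊆ X_{n+1}(0)`: the last step's core is reached
    have hlastlink : T'' (Fin.last n) ⊆ (s (Fin.last (n + 1))).L.X 0 := by
      have := hlink (Fin.last n)
      simp only [hT'']
      rwa [Fin.succ_last] at this
    have holast : (s (Fin.last (n + 1))).L.o = (s 0).L.o := ho _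
    have hsubB : (⋃ t ∈ T'' (Fin.last n), openConn (s 0).L.o t) ⊆ (s (Fin.last (n + 1))).L.reachB := by
      intro ω hω
      simp only [Set.mem_iUnion, exists_prop] at hω
      obtain ⟨t, ht, hωt⟩ := hω
      unfold LData.reachB
      rw [holast]
      exact Set.mem_biUnion (Finset.mem_coe.2 (hlastlink ht)) hωt
    have hreachLast : 1 - δ₁ < (prodBernoulli W).real (s (Fin.last (n + 1))).L.reachB := by
      rw [h0] at hmid
      exact lt_of_lt_of_le hmid (measureReal_mono hsubB (measure_ne_top _ _))
    have h1 := hlast p hp1 G hΔ W (s (Fin.last (n + 1))) ((hk _).mono hmin1) hreachLast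
    rw [holast] at h1
    have h2 := real_biUnion_openConn_le_add_sdiff (prodBernoulli W) (s 0).L.o (hsub (Fin.last (n + 1)))
    have h3 := hexc (Fin.last (n + 1))
    have h4 : η ≤ ε / 2 := hη.trans (by linarith)
    linarith

end KNLevels

end Transplant

end Summit.CriticalPhenomena.PercolationContinuityZ3.Theorems

end
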